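import Summits.QuantumFields.BalabanUV.T4Continuum.Spine.NE1p.DressedStabilityOfCanonicalSliceWinSchedules
import Summits.QuantumFields.BalabanUV.T4Continuum.Spine.NE1p.DressedExponentDepth

/-!
# T⁴ programme, spine estimate NE1′ (node O3b/H2) — THE CANONICAL TERMINAL FACE ∘ (VAL-θ) DEPTH: the (w2-act) exponent binder
# `hE` of the crew's terminal theorem READ AS A HISTORY-INDEXED SUM, THE NUMBER displayed in the escrow currency, with NO
# bookkeeping equality displayed (swarm item «S3m» of `t4/formal/NE1p/LEAVES.md`, own-initiative composition in the
# S3i∕S3j∕S3k∕S3k.1∕S3l pattern «supplier ∘ terminal face»; INTENT HOME/CLAIMS.log l.11242, GO by the S3l author l.11264,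
# BOOKED typer R-T56 l.11325 → DAG node N23m)

Cell `pub-balaban`, sub-cell `t4`, BINDER-OWNERS row NE1′ (owner lineage t4-ne1p-p1; root `Spine/NE1p/DressedRoot.lean` p211416),
formalisation crew `b2b-balaban-t4-ne1p-formalise-*`, seat `…-leaf-01` (gen 4; lineage rows S2∕S2b∕S2c∕S2d∕S2i∕S2j∕S2k∕W6).  ADDITIVE —
imports leaf-09-g3's CANONICAL TERMINAL FACE `Spine/NE1p/DressedStabilityOfCanonicalSliceWinSchedules` (row S3l p215128:
`dressedStability_of_canonicalSliceWinSchedules` — END-ALL-slice-win ∘ suppliers over the canonical data, NO bookkeeping function or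
equality displayed) and leaf-04-g2's (VAL-θ) supplier `Spine/NE1p/DressedExponentDepth` (row S9 p215209: `exponentSliceAt_of_valDepth`,
road P2 gen 34's piece lemmas credited there) ONLY; modifies nothing.

WHY.  After S3l the crew's terminal theorem displays, per `(a, K)`, the (w2-act) exponent binder
  `hE : … → ExponentSliceAt (ref a K b k) (𝒜 a K b k) (μ a K b k) latMove latN (bondBall d ((W a K).ρw (k+1))) ((W a K).wc (k+1))
         ((W a K).ϱc k) (s a K b k)`
— ONE margin `s a K b k` per met component bounding the oscillation of the action exponent along every admissible complex chart move —
and THE NUMBER as `hs₀ : s a K b k ≤ s̄⁰`.  Row S9 typed road P2's route-R1 READING of that margin (ideation output No. 20, item (S3)):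
the exponent is the new step's own part plus finitely many OLD PIECES carried from their birth steps, each analytic with sup `N_i` on
its (thick) birth domain, and the VALUE MAP of the old layers moves under a current-scale chart move by at most `c_V·θ_i·ρ_i` inside the
room `ρ_i` ((VAL-θ) — printed TYPE [Balaban1985Variational] p. 307 only; its composition through [Balaban1989LargeFieldII] (1.61)–(1.63)
is NOT printed: a NEW located estimate of road P2, DISPLAYED, never asserted); then `hE` holds with `s := s_new + Σ_i 2·N_i·(c_V θ_i)`
(`DressedExponentDepth.exponentSliceAt_of_valDepth`).  This file carries that supplier to the END-ALL level, exactly as rows S3i∕S3j∕S3k∕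
S3k.1 carried the F-8∕L-C∕L-B suppliers into the END-ALL faces: S3l's three theorems BY NAME, instantiated at the history-indexed
margin ITSELF — `(s := fun a K b k => snew a K b k + Σ_{i ∈ I a K b k} 2·N a K b k i·(cV·θ a K b k i))`, so that NO equality binder for `s`
enters the list S3l emptied (typer R-T56 (c), S3l author's note l.11264 (ii)) — with `hE` DISCHARGED per `(a, K, b, k′, k)` by ONE application
of `exponentSliceAt_of_valDepth` BY NAME.  The terminal face then displays, IN PLACE OF `hE`, exactly row S9's data in its letters, as
FAMILIES indexed by `(a, K, b, k)` (index types `ι a K`, layer-value spaces `E a K`):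
* the layered DICTIONARY `h𝒜 : 𝒜 a K b k U z = 𝒜new a K b k U z + Σ_{i ∈ I a K b k} t a K b k i (val a K b k U i) z` (S9's `h𝒜`; what the
  instantiation DEFINES, like the H2 dictionary `hQ` — asserted for Bałaban's densities nowhere);
* the new step's OWN slice `hnew : … → ExponentSliceAt (ref a K b k) (𝒜new a K b k) … (snew a K b k)` (guarded exactly like `hE`);
* the old pieces: open birth domains `hDom`, a.e.-in-`z` holomorphy `ht`, measurability `htm`, sups `hN` ((1.69)-TYPE per-birth READING,
  under XREAD Q-age-0 — delivered «CARRIED» by lit-proposed-g12, CLAIMS.log l.10868), rooms `hroom0`∕`hroom` about the reference values of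
  the window points;
* THE (VAL-θ) BLOCK `hval` — VERBATIM S9's binder (`∃ Ω` BEFORE `∀ i ∈ I`), under `hE`'s guard prefix, at `𝒦 = bondBall d ((W a K).ρw (k+1))`,
  `w = (W a K).wc (k+1)`, `ϱ = (W a K).ϱc k` — with its signs `hq0`∕`hq1` (`0 < c_V θ_i < 1`); ONE K-free `cV` before `∀ a K` (caveat k1:
  no cutoff hidden in `cV` or `s̄⁰`);
and THE NUMBER DIRECTLY in the escrow currency, in each theorem's header:
  `hs₀ : ∀ a K b k, snew a K b k + Σ_{i ∈ I a K b k} 2·N a K b k i·(cV·θ a K b k i) ≤ s̄⁰`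
(with per-birth counts `N_i ≤ N̄·n_i` it reads `snew + 2N̄c_V·Σ n_iθ_i ≤ s̄⁰` by S9's `margin_le_of_counts`; road P2's escrow arithmetic (S4)
is NOT a tree object and is NOT used here).  Every budget gate `budgetGate (𝒯.T a K) s …` of S3l's telescope displays the same margin
lambda in place of `s a K`; every OTHER binder of S3l — (w1) `hsl`; (w2-act) `hB`; (w5) `hreg` + `hc0`∕`hcb`; (I4′) `hδf`∕`hδfwk`∕`hpairx`∕
`hdefwk`∕`hrate` + `hcm`; the F-2∕H2 dictionary `hFn`∕`h𝒢`∕`hQ`∕`hSg`∕`hmeas`; F-9 context `hinv`∕`hDμ`∕`hz₁`; the schedules `W` + `hratio`;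
anchoring ∕ absorption ∕ booking-convention DATA; row S3's located scalars ONCE — is displayed VERBATIM (S3l's §2 telescope minus `hE`∕`hs₀`,
token for token up to that substitution).  CENSUS: S3l's 50 explicit − 1 (`hE`) + 11 (`h𝒜`, `hnew`, `hDom`, `ht`, `htm`, `hN`, `hroom0`,
`hroom`, `hval`, `hq0`, `hq1`) = **60 explicit**, bookkeeping equalities 0.  R4 rider (caveat k1) INHERITED from S3l by reference and
restated in one line: the component volume `v` and the multiplicity `mB` are bound ONCE — K-free for COLLARED met components only (row S4
`DressedPositionalCount`); NOT asserted here for Bałaban's large-field components.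

* §1 the tower-level binders ONCE as section variables = S3l's telescope MINUS `hE`∕`hs₀` and MINUS the family `s`, PLUS the depth
  families; the dictionary `h𝒜` and THE NUMBER `hs₀` (escrow currency) sit in each theorem's header next to S3l's `hQ`∕`hSg`∕`hcm`∕`hδfwk`
  (statements header-distinct from S3l∕S3l.1∕S3k∕S3i).
* §2 **`dressedStability_of_depthSliceWinSchedules : DressedStability 𝒯`**, `dressedStabilityWith_of_depthSliceWinSchedules` (constants
  `(A₀, rhoOne L⁻² (4c_δ∕r) c̄ κ, L⁻³)` displayed) and ROOT-B **`dressedBudget_of_depthSliceWinSchedules : DressedBudget 𝒯 wt`** = S3l's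
  three theorems BY NAME at `(s := fun a K b k => snew … + Σ …)` with `hE := exponentSliceAt_of_valDepth (I a K b k) (h𝒜 a K b k) …`.
  Theorems only; nothing of S3l ∕ S3k ∕ S9 is re-proved (S9 §1's piece lemmas are not re-derived); conclusions literal.

HEADLINE (c4, typer R-T56 (e) verbatim): «NE1′ ⇐ EXACTLY the displayed WALL∕Q binders with (w2-act) `hE` READ THROUGH (VAL-θ) +
pieces-analyticity data — (VAL-θ) is road P2's NEW located estimate, in print only as a TYPE (B12 p. 307), asserted nowhere; THE NUMBER
`hs₀` displayed in escrow currency, untouched; NE1′ NOT proved; spine 0∕9; finite T⁴».  One level finer display at the END-ALL level;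
mints no wall.

HONEST FRAMING.  Kernel composition over hypothesis shapes ([folklore]; theorems only; 0 sorry; 0 citations used as facts; no `def`,
no `def … : Prop`).  (VAL-θ) and the per-birth reading of (1.69) are asserted NOWHERE; whether the summed margin is K-uniformly
below `s̄⁰ < 1` on Bałaban's densities is road P2's escrow + (VAL-θ)'s instantiation — the wall, displayed; 0 binders instantiated on
Bałaban's densities; spine PROVED 0∕9.  Rung (B)+1 on ONE finite four-torus of fixed physical size — NOT infinite volume, NOT a mass gap,
NOT OS on ℝ⁴, NOT the Clay problem.  HONEST DEPENDENCY: continuum YM on T⁴ ⇐ BetaPertH ∧ nine spine estimates (0/9 proved); BetaPertH ⇐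
(D1) ∧ (D4) ∧ CAP+tail; G-an2-4 gates asym, D1 and NE2/3/4.
-/

noncomputable section

namespace Summit.QuantumFields.BalabanUV.T4Continuum.NE1p.DressedStabilityOfDepthSliceWinSchedules

open MeasureTheory Set Metric Finset
open scoped BigOperators
open Literature.MathematicalPhysics.QuantumFieldTheory.Balaban1983to89
open Literature.MathematicalPhysics.QuantumFieldTheory.Balaban1983to89.T4TermFormat
open Literature.MathematicalPhysics.QuantumFieldTheory.Balaban1983to89.T4FeltGeometry
open Literature.MathematicalPhysics.QuantumFieldTheory.Balaban1983to89.T4GatedBooking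
open Literature.MathematicalPhysics.QuantumFieldTheory.Balaban1983to89.T4TrajectoryComparison
open Literature.MathematicalPhysics.QuantumFieldTheory.Balaban1983to89.T4TrajectoryModulus
open T4BirthChartTransport (GaugeInvariant BirthSlice RelGauge)
open T4BlockTransport (Fld NDir latMove latN)
open T4TrajectoryDensity
open Summit.QuantumFields.BalabanUV.T4Continuum.T4TrajectoryDensityDressed
open Summit.QuantumFields.BalabanUV.T4Continuum.NE1p.DressedRoot
open Summit.QuantumFields.BalabanUV.T4Continuum.NE1p.DressedWindowScheduleWin
open Summit.QuantumFields.BalabanUV.T4Continuum.NE1p.DressedWindowScheduleModWin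
open Summit.QuantumFields.BalabanUV.T4Continuum.NE1p.DressedUniformConstants
open Summit.QuantumFields.BalabanUV.T4Continuum.NE1p.DressedStabilityOfCanonicalSliceWinSchedules
open Summit.QuantumFields.BalabanUV.T4Continuum.NE1p.DressedExponentDepth
open Summit.QuantumFields.BalabanUV.T4Continuum.NE1p.DressedAbsorptionWindow

/-! ## §1 The tower-level binders, once — S3l's telescope minus `hE`∕`hs₀`, plus the (VAL-θ)∕depth families -/

section EndAll

variable {P : Type*} (𝒯 : DressedTower P)
variable {R : Type*} [NormedRing R] [NormedAlgebra ℂ R] [MeasurableSpace R] {d : ℕ}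
variable {κ L cbar N₀ A₀ sbar ρ' r cδ m : ℝ} {w : P → ℕ → ℝ}
variable (W : ∀ (a : P) (K : ℕ), WindowScheduleModWin r (w a K)) (hκ : 0 ≤ κ)
variable {Fn : ∀ (a : P) (K : ℕ), (𝒯.B a K).Birth → ℕ → ℕ → Fld d R → ℂ}
  {rel : ∀ (a : P) (K : ℕ), (𝒯.B a K).Birth → ℕ → ℕ → Fld d R → Fld d R → Prop}
  {ref : ∀ (a : P) (K : ℕ), (𝒯.B a K).Birth → ℕ → Fld d R → Fld d R}
  {base : ∀ (a : P) (K : ℕ), (𝒯.B a K).Birth → ℕ → Fld d R → ℝ}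
  {𝒜 𝒬 : ∀ (a : P) (K : ℕ), (𝒯.B a K).Birth → ℕ → Fld d R → Fld d R → ℂ}
  {q : ∀ (a : P) (K : ℕ), (𝒯.B a K).Birth → ℕ → Fld d R → ℂ}
  {μ : ∀ (a : P) (K : ℕ), (𝒯.B a K).Birth → ℕ → Measure (Fld d R)}
  {z₀ z₁ : ∀ (a : P) (K : ℕ), (𝒯.B a K).Birth → ℕ → Fld d R}
  {defect : ∀ (a : P) (K : ℕ), (𝒯.B a K).Birth → ℕ → ℕ → ℝ}
  {S : ∀ (a : P) (K : ℕ), ℕ → (𝒯.B a K).Birth → Finset (𝒯.B a K).Birth}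
  {Sg : ∀ (a : P) (K : ℕ), ℕ → (𝒯.B a K).Birth → Finset ((𝒯.B a K).Birth × ℕ)}
  {c : ∀ (a : P) (K : ℕ), (𝒯.B a K).Birth → ℕ → ℂ}
  {δf : ∀ (a : P) (K : ℕ), (𝒯.B a K).Birth → ℕ → (𝒯.B a K).Birth × ℕ → ℝ}
  {creg : ∀ (_ : P) (_ : ℕ), ℕ → ℝ}
-- DATA replacing the structural leaves: anchoring (L-C), absorption (L-B) — S3l verbatim
variable {Lb mB v : ℕ} (Anch : ∀ (a : P) (K : ℕ), Anchoring (𝒯.B a K) 4 Lb)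
  {comp : ∀ (a : P) (K : ℕ), ℕ → (𝒯.B a K).Birth → Finset (𝒯.B a K).Cube}
  {Sabs : ∀ (a : P) (K : ℕ), (𝒯.B a K).Birth → Finset (𝒯.B a K).Birth}
  {β : ∀ (_ : P) (_ : ℕ), ℕ → ℝ} {A β₀ : ℝ}
-- THE (VAL-θ) ∕ DEPTH FAMILIES (row S9's letters, indexed by run parameter, cutoff, family, step): index types of the old pieces,
-- layer-value spaces, the pieces carried, the new step's own exponent and margin, sups, depth factors, rooms — and ONE K-free `cV`
variable {ι : P → ℕ → Type*} {E : P → ℕ → Type*} [∀ a K, NormedAddCommGroup (E a K)] [∀ a K, NormedSpace ℂ (E a K)]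
  {I : ∀ (a : P) (K : ℕ), (𝒯.B a K).Birth → ℕ → Finset (ι a K)}
  {𝒜new : ∀ (a : P) (K : ℕ), (𝒯.B a K).Birth → ℕ → Fld d R → Fld d R → ℂ}
  {snew : ∀ (a : P) (K : ℕ), (𝒯.B a K).Birth → ℕ → ℝ}
  {val : ∀ (a : P) (K : ℕ), (𝒯.B a K).Birth → ℕ → Fld d R → ι a K → E a K}
  {t : ∀ (a : P) (K : ℕ), (𝒯.B a K).Birth → ℕ → ι a K → E a K → Fld d R → ℂ}
  {Dom : ∀ (a : P) (K : ℕ), (𝒯.B a K).Birth → ℕ → ι a K → Set (E a K)}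
  {N θ room : ∀ (a : P) (K : ℕ), (𝒯.B a K).Birth → ℕ → ι a K → ℝ} {cV : ℝ}

-- the ratio family (K-free κ)
variable (hratio : ∀ (a : P) (K : ℕ), ∀ k, 2 * (W a K).σ k ≤ κ * (W a K).ϱc k)
-- row S3's located scalars ((w7) largeness, (w6) window) and signs — ONCE
variable (hL : 1 ≤ L)
variable (hcbar : 0 ≤ cbar)
variable (hN₀ : 0 ≤ N₀)
variable (hA₀ : 0 ≤ A₀)
variable (hm : 0 ≤ m)
variable (hloc : locCell L (4 * cδ / r) cbar κ ≤ ρ')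
variable (hρ'1 : ρ' < 1)
variable (hsmall : m * (N₀ * A₀ * (1 - ρ')⁻¹) ≤ 1 - sbar)
variable (hr : 0 < r)
variable (hcδ : 0 ≤ cδ)
-- the assembled END's estimate families (S3l verbatim, WITHOUT `hE`)
variable (hsl : ∀ (a : P) (K : ℕ), ∀ (b : (𝒯.B a K).Birth) (k' : ℕ), (𝒯.B a K).birthScale b ≤ k' → k' ≤ (𝒯.B a K).K →
  RanBelow (budgetGate (𝒯.T a K) (fun b k => (snew a K) b k + ∑ i ∈ (I a K) b k, 2 * (N a K) b k i * (cV * (θ a K) b k i))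
    m (S a K) (4 * cδ / r) (fun i => (L ^ 2)⁻¹ * (fun _ : ℕ => alphaCell κ) i)) k' →
  BirthSlice ((Fn a K) b k' k') latMove latN (bondBall d ((W a K).ρw k') : Set (Fld d R)) ((W a K).wc k') r ((𝒯.T a K).gen b k'))
variable (hFn : ∀ (a : P) (K : ℕ), ∀ (b : (𝒯.B a K).Birth) (k' k : ℕ), (𝒯.B a K).birthScale b ≤ k' → k' ≤ k →
  k + 1 ≤ (𝒯.B a K).K →
  RanBelow (budgetGate (𝒯.T a K) (fun b k => (snew a K) b k + ∑ i ∈ (I a K) b k, 2 * (N a K) b k i * (cV * (θ a K) b k i))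
    m (S a K) (4 * cδ / r) (fun i => (L ^ 2)⁻¹ * (fun _ : ℕ => alphaCell κ) i)) (k + 1) →
  ∀ U, (Fn a K) b k' (k + 1) U =
    wOp (expWeight ((base a K) b k) ((𝒜 a K) b k + (𝒬 a K) b k)) ((μ a K) b k) ((z₀ a K) b k) U (fun z => (Fn a K) b k' k (U + z)))
variable (h𝒢 : ∀ (a : P) (K : ℕ), ∀ (b : (𝒯.B a K).Birth) (k' k : ℕ), (𝒯.B a K).birthScale b ≤ k' → k' ≤ k →
  k + 1 ≤ (𝒯.B a K).K →
  RanBelow (budgetGate (𝒯.T a K) (fun b k => (snew a K) b k + ∑ i ∈ (I a K) b k, 2 * (N a K) b k i * (cV * (θ a K) b k i))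
    m (S a K) (4 * cδ / r) (fun i => (L ^ 2)⁻¹ * (fun _ : ℕ => alphaCell κ) i)) (k + 1) →
  ∀ U, (fun z => (Fn a K) b k' k (U + z)) ∈ BddClass ℂ ((μ a K) b k))
variable (hB : ∀ (a : P) (K : ℕ), ∀ (b : (𝒯.B a K).Birth) (k' k : ℕ), (𝒯.B a K).birthScale b ≤ k' → k' ≤ k →
  k + 1 ≤ (𝒯.B a K).K →
  RanBelow (budgetGate (𝒯.T a K) (fun b k => (snew a K) b k + ∑ i ∈ (I a K) b k, 2 * (N a K) b k i * (cV * (θ a K) b k i))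
    m (S a K) (4 * cδ / r) (fun i => (L ^ 2)⁻¹ * (fun _ : ℕ => alphaCell κ) i)) (k + 1) →
  RealBaseAt ((ref a K) b k) ((base a K) b k) ((𝒜 a K) b k) ((μ a K) b k) (bondBall d ((W a K).ρw (k + 1)) : Set (Fld d R)))
-- (w2-act)'s `hE` REPLACED BY THE (VAL-θ) ∕ DEPTH DATA (row S9): the new step's own slice, the old pieces on their birth domains
-- (open, a.e.-holomorphic in the value with sups `N`, measurable in the fluctuation, rooms about the reference values), and the
-- (VAL-θ) block — holomorphic value map along every admissible chart move, displacement `≤ cV·θ·room` — with its signs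
variable (hnew : ∀ (a : P) (K : ℕ), ∀ (b : (𝒯.B a K).Birth) (k' k : ℕ), (𝒯.B a K).birthScale b ≤ k' → k' ≤ k →
  k + 1 ≤ (𝒯.B a K).K →
  RanBelow (budgetGate (𝒯.T a K) (fun b k => (snew a K) b k + ∑ i ∈ (I a K) b k, 2 * (N a K) b k i * (cV * (θ a K) b k i))
    m (S a K) (4 * cδ / r) (fun i => (L ^ 2)⁻¹ * (fun _ : ℕ => alphaCell κ) i)) (k + 1) →
  ExponentSliceAt ((ref a K) b k) ((𝒜new a K) b k) ((μ a K) b k) latMove latN (bondBall d ((W a K).ρw (k + 1)) : Set (Fld d R))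
    ((W a K).wc (k + 1)) ((W a K).ϱc k) ((snew a K) b k))
variable (hDom : ∀ (a : P) (K : ℕ), ∀ b k, ∀ i ∈ (I a K) b k, IsOpen ((Dom a K) b k i))
variable (ht : ∀ (a : P) (K : ℕ), ∀ (b : (𝒯.B a K).Birth) (k' k : ℕ), (𝒯.B a K).birthScale b ≤ k' → k' ≤ k →
  k + 1 ≤ (𝒯.B a K).K →
  RanBelow (budgetGate (𝒯.T a K) (fun b k => (snew a K) b k + ∑ i ∈ (I a K) b k, 2 * (N a K) b k i * (cV * (θ a K) b k i))
    m (S a K) (4 * cδ / r) (fun i => (L ^ 2)⁻¹ * (fun _ : ℕ => alphaCell κ) i)) (k + 1) →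
  ∀ i ∈ (I a K) b k, ∀ᵐ z ∂(μ a K) b k, DifferentiableOn ℂ (fun V => (t a K) b k i V z) ((Dom a K) b k i))
variable (htm : ∀ (a : P) (K : ℕ), ∀ b k, ∀ i ∈ (I a K) b k, ∀ V ∈ (Dom a K) b k i,
  AEStronglyMeasurable (fun z => (t a K) b k i V z) ((μ a K) b k))
variable (hN : ∀ (a : P) (K : ℕ), ∀ (b : (𝒯.B a K).Birth) (k' k : ℕ), (𝒯.B a K).birthScale b ≤ k' → k' ≤ k →
  k + 1 ≤ (𝒯.B a K).K →
  RanBelow (budgetGate (𝒯.T a K) (fun b k => (snew a K) b k + ∑ i ∈ (I a K) b k, 2 * (N a K) b k i * (cV * (θ a K) b k i))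
    m (S a K) (4 * cδ / r) (fun i => (L ^ 2)⁻¹ * (fun _ : ℕ => alphaCell κ) i)) (k + 1) →
  ∀ i ∈ (I a K) b k, ∀ᵐ z ∂(μ a K) b k, ∀ V ∈ (Dom a K) b k i, ‖(t a K) b k i V z‖ ≤ (N a K) b k i)
variable (hroom0 : ∀ (a : P) (K : ℕ), ∀ b k, ∀ i ∈ (I a K) b k, 0 < (room a K) b k i)
variable (hroom : ∀ (a : P) (K : ℕ), ∀ (b : (𝒯.B a K).Birth) (k' k : ℕ), (𝒯.B a K).birthScale b ≤ k' → k' ≤ k →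
  k + 1 ≤ (𝒯.B a K).K →
  RanBelow (budgetGate (𝒯.T a K) (fun b k => (snew a K) b k + ∑ i ∈ (I a K) b k, 2 * (N a K) b k i * (cV * (θ a K) b k i))
    m (S a K) (4 * cδ / r) (fun i => (L ^ 2)⁻¹ * (fun _ : ℕ => alphaCell κ) i)) (k + 1) →
  ∀ i ∈ (I a K) b k, ∀ U₀ ∈ (bondBall d ((W a K).ρw (k + 1)) : Set (Fld d R)),
    ball ((val a K) b k ((ref a K) b k U₀) i) ((room a K) b k i) ⊆ (Dom a K) b k i)
variable (hval : ∀ (a : P) (K : ℕ), ∀ (b : (𝒯.B a K).Birth) (k' k : ℕ), (𝒯.B a K).birthScale b ≤ k' → k' ≤ k →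
  k + 1 ≤ (𝒯.B a K).K →
  RanBelow (budgetGate (𝒯.T a K) (fun b k => (snew a K) b k + ∑ i ∈ (I a K) b k, 2 * (N a K) b k i * (cV * (θ a K) b k i))
    m (S a K) (4 * cδ / r) (fun i => (L ^ 2)⁻¹ * (fun _ : ℕ => alphaCell κ) i)) (k + 1) →
  ∀ U₀ ∈ (bondBall d ((W a K).ρw (k + 1)) : Set (Fld d R)), ∀ p : NDir d R, 0 < latN p → latN p ≤ (W a K).wc (k + 1) →
    ∃ Ω : Set ℂ, IsOpen Ω ∧ (∀ x ∈ Icc (0 : ℝ) 1, closedBall (x : ℂ) ((W a K).ϱc k / latN p) ⊆ Ω) ∧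
      ∀ i ∈ (I a K) b k, DifferentiableOn ℂ (fun τ => (val a K) b k (latMove U₀ p τ) i) Ω ∧
        ∀ τ ∈ Ω, ‖(val a K) b k (latMove U₀ p τ) i - (val a K) b k ((ref a K) b k U₀) i‖ ≤
          cV * (θ a K) b k i * (room a K) b k i)
variable (hq0 : ∀ (a : P) (K : ℕ), ∀ b k, ∀ i ∈ (I a K) b k, 0 < cV * (θ a K) b k i)
variable (hq1 : ∀ (a : P) (K : ℕ), ∀ b k, ∀ i ∈ (I a K) b k, cV * (θ a K) b k i < 1)
-- the remaining estimate ∕ dictionary ∕ context families (S3l verbatim)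
variable (hδf : ∀ (a : P) (K : ℕ), ∀ b k, ∀ x ∈ (Sg a K) k b, 0 ≤ (δf a K) b k x ∧ (δf a K) b k x ≤ cδ * ((L ^ 2)⁻¹) ^ (k - x.2))
variable (hDμ : ∀ (a : P) (K : ℕ), ∀ b k, ∀ᵐ z ∂(μ a K) b k, z ∈ (bondBall d ((W a K).σ k) : Set (Fld d R)))
variable (hz₁ : ∀ (a : P) (K : ℕ), ∀ b k, (z₁ a K) b k ∈ (bondBall d ((W a K).σ k) : Set (Fld d R)))
variable (hpairx : ∀ (a : P) (K : ℕ), ∀ (b : (𝒯.B a K).Birth) (k' k : ℕ), (𝒯.B a K).birthScale b ≤ k' → k' ≤ k →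
  ∀ x ∈ (Sg a K) k b, ∀ U₀ ∈ (bondBall d ((W a K).ρw (k + 1)) : Set (Fld d R)), ∀ pd : NDir d R, 0 < latN pd →
    latN pd ≤ (W a K).wc (k + 1) →
    ∀ᵐ z ∂(μ a K) b k, ∀ t ∈ tube ((W a K).ϱ₁ k / latN pd),
      RelGauge ((rel a K) x.1 x.2 k) latMove latN (latMove U₀ pd t + (z₁ a K) b k) (latMove U₀ pd t + z) ((δf a K) b k x))
variable (hinv : ∀ (a : P) (K : ℕ), ∀ b k' k, GaugeInvariant ((rel a K) b k' k) ((Fn a K) b k' k))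
variable (hmeas : ∀ (a : P) (K : ℕ), ∀ (b f : (𝒯.B a K).Birth) (k'' k : ℕ) (U : Fld d R),
  AEStronglyMeasurable (fun z => (Fn a K) f k'' k (U + z)) ((μ a K) b k))
variable (hdefwk : ∀ (a : P) (K : ℕ), ∀ (b : (𝒯.B a K).Birth) (k' k : ℕ), (defect a K) b k' k ≤ (W a K).wc k)
variable (hrate : ∀ (a : P) (K : ℕ), ∀ (b : (𝒯.B a K).Birth) (k' k : ℕ), (𝒯.B a K).birthScale b ≤ k' → k' ≤ k → k ≤ (𝒯.B a K).K →
  (defect a K) b k' k ≤ cδ * ((L ^ 2)⁻¹) ^ (k - k'))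
-- F-8 REPLACED BY THE BOOKING CONVENTION (row S8): admissible pairs exist, booked size ≤ sup of realised increments
variable (hne : ∀ (a : P) (K : ℕ), ∀ (b : (𝒯.B a K).Birth) (k' k : ℕ), (𝒯.B a K).birthScale b ≤ k' → k' ≤ k → k ≤ (𝒯.B a K).K →
  RanBelow (budgetGate (𝒯.T a K) (fun b k => (snew a K) b k + ∑ i ∈ (I a K) b k, 2 * (N a K) b k i * (cV * (θ a K) b k i))
    m (S a K) (4 * cδ / r) (fun i => (L ^ 2)⁻¹ * (fun _ : ℕ => alphaCell κ) i)) k →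
  ∃ U₀ ∈ (bondBall d ((W a K).ρw k) : Set (Fld d R)), ∃ U₁ : Fld d R,
  RelGauge ((rel a K) b k' k) latMove latN U₀ U₁ ((defect a K) b k' k))
variable (hsup : ∀ (a : P) (K : ℕ), ∀ (b : (𝒯.B a K).Birth) (k' k : ℕ), (𝒯.B a K).birthScale b ≤ k' → k' ≤ k → k ≤ (𝒯.B a K).K →
  RanBelow (budgetGate (𝒯.T a K) (fun b k => (snew a K) b k + ∑ i ∈ (I a K) b k, 2 * (N a K) b k i * (cV * (θ a K) b k i))
    m (S a K) (4 * cδ / r) (fun i => (L ^ 2)⁻¹ * (fun _ : ℕ => alphaCell κ) i)) k →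
  (𝒯.T a K).lin b k' k ≤ sSup {x : ℝ | ∃ U₀ ∈ (bondBall d ((W a K).ρw k) : Set (Fld d R)), ∃ U₁ : Fld d R,
    RelGauge ((rel a K) b k' k) latMove latN U₀ U₁ ((defect a K) b k' k) ∧ x = ‖(Fn a K) b k' k U₁ - (Fn a K) b k' k U₀‖})
-- the booking-level wall binders: (w5) regeneration — THE NUMBER's `hs₀` sits in the theorem headers, in the escrow currency
variable (hc0 : ∀ (a : P) (K : ℕ), ∀ k, 0 ≤ (creg a K) k)
variable (hcb : ∀ (a : P) (K : ℕ), ∀ k, k < (𝒯.B a K).K → (creg a K) k ≤ cbar)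
variable (hreg : ∀ (a : P) (K : ℕ), (𝒯.T a K).RegeneratesFromVar (creg a K)
  (budgetGate (𝒯.T a K) (fun b k => (snew a K) b k + ∑ i ∈ (I a K) b k, 2 * (N a K) b k i * (cV * (θ a K) b k i))
    m (S a K) (4 * cδ / r) (fun _ : ℕ => (L ^ 2)⁻¹ * alphaCell κ)))
-- (w3-book) L-C REPLACED BY ANCHORING DATA (row S4): blocking integer, multiplicity, housing, component volume
variable (hLb : (Lb : ℝ) = L)
variable (hmult : ∀ (a : P) (K : ℕ), ∀ j (x : Fin 4 → ℕ),
  ((𝒯.B a K).births.filter fun b => (𝒯.B a K).birthScale b = j ∧ x ∈ (Anch a K).dom b).card ≤ mB)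
variable (hscale : ∀ (a : P) (K : ℕ), ∀ k b, ∀ q ∈ (comp a K) k b, (𝒯.B a K).cubeScale q = k)
variable (hhoused : ∀ (a : P) (K : ℕ), ∀ k b, ∀ f ∈ (S a K) k b, ∃ q ∈ (comp a K) k b, f ∈ (𝒯.B a K).feltAt q)
variable (hvol : ∀ (a : P) (K : ℕ), ∀ k b, ((comp a K) k b).card ≤ v)
-- (w1)+(w5b) L-B REPLACED BY ABSORPTION DATA (rows S5 ∕ S5b)
variable (holder : ∀ (a : P) (K : ℕ), ∀ b b₀, b₀ ∈ (Sabs a K) b → (𝒯.B a K).birthScale b₀ < (𝒯.B a K).birthScale b)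
variable (hsub : ∀ (a : P) (K : ℕ), ∀ b, (Sabs a K) b ⊆ (S a K) ((𝒯.B a K).birthScale b) b)
variable (habs : ∀ (a : P) (K : ℕ), (𝒯.T a K).AbsorbsFrom (4 * cδ / r) (fun _ : ℕ => (L ^ 2)⁻¹ * alphaCell κ) (β a K) A (Sabs a K)
  (budgetGate (𝒯.T a K) (fun b k => (snew a K) b k + ∑ i ∈ (I a K) b k, 2 * (N a K) b k i * (cV * (θ a K) b k i))
    m (S a K) (4 * cδ / r) (fun _ : ℕ => (L ^ 2)⁻¹ * alphaCell κ)))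
variable (hβ : ∀ (a : P) (K : ℕ), ∀ j, j ≤ (𝒯.B a K).K → (β a K) j ≤ β₀ * (L⁻¹ ^ 3) ^ ((𝒯.B a K).K - j))

include W hκ Anch hratio hL hcbar hN₀ hA₀ hm hloc hρ'1 hsmall hr hcδ hsl hFn h𝒢 hB hnew hDom ht htm hN hroom0 hroom hval hq0 hq1
  hδf hDμ hz₁ hpairx hinv hmeas hdefwk hrate hne hsup hc0 hcb hreg hLb hmult hscale hhoused hvol holder hsub habs hβ

/-! ## §2 The canonical terminal face ∘ (VAL-θ) depth: the row root (both forms) and ROOT-B -/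

/-- **THE CANONICAL TERMINAL FACE ∘ (VAL-θ) DEPTH — THE ROW ROOT WITH ITS CONSTANTS DISPLAYED** [bookkeeping]: S3l's
`dressedStabilityWith_of_canonicalSliceWinSchedules` BY NAME at the history-indexed margin `(s := fun a K b k => snew a K b k +
Σ_{i ∈ I a K b k} 2·N a K b k i·(cV·θ a K b k i))`, with the (w2-act) exponent binder `hE` DISCHARGED, per `(a, K, b, k′, k)`, from the
displayed (VAL-θ)∕depth data by ONE application of row S9's `exponentSliceAt_of_valDepth`.  The header displays the layered dictionary `h𝒜`,
THE NUMBER `hs₀` in the escrow currency `snew + Σ 2N_i c_V θ_i ≤ s̄⁰`, S3l's H2 dictionary `hQ`∕`hSg`, the two binders particular to the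
slice-window face `hcm`∕`hδfwk`, and row S3's supplier scalars.  The scalars (`κ L c̄ N₀ A₀ s̄⁰ ρ′ r c_δ m cV v mB A
β₀`) precede `∀ a K`.  NOT «NE1′ proved»: every wall binder displayed — `hE` one level finer —; (VAL-θ) asserted nowhere; 0
instantiated on Bałaban's densities. [folklore] -/
theorem dressedStabilityWith_of_depthSliceWinSchedules
    -- the (VAL-θ) DICTIONARY: the action exponent IS the new step's part plus the old pieces at the layer values
    (h𝒜 : ∀ (a : P) (K : ℕ), ∀ b k, ∀ U z,
      (𝒜 a K) b k U z = (𝒜new a K) b k U z + ∑ i ∈ (I a K) b k, (t a K) b k i ((val a K) b k U i) z)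
    -- THE NUMBER, charged in the escrow currency (the history-indexed margin below `s̄⁰`)
    (hs₀ : ∀ (a : P) (K : ℕ), ∀ b k, (snew a K) b k + ∑ i ∈ (I a K) b k, 2 * (N a K) b k i * (cV * (θ a K) b k i) ≤ sbar)
    -- the H2 dictionary the canonical data are built from (S3l)
    (hQ : ∀ (a : P) (K : ℕ), ∀ b k, (fun U z => (𝒬 a K) b k U z - (q a K) b k U) =
      fun U z => (c a K) b k * ∑ x ∈ (Sg a K) k b, ((Fn a K) x.1 x.2 k (U + z) - (Fn a K) x.1 x.2 k (U + (z₁ a K) b k)))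
    (hSg : ∀ (a : P) (K : ℕ), ∀ k b, ∀ x ∈ (Sg a K) k b, x.1 ∈ (S a K) k b ∧ (𝒯.B a K).birthScale x.1 ≤ x.2 ∧ x.2 ≤ k)
    -- the two binders PARTICULAR to the assembled slice-window face (cutoff-free source tie, per-step slice guard)
    (hcm : ∀ (a : P) (K : ℕ), ∀ b k, ‖(c a K) b k‖ ≤ m)
    (hδfwk : ∀ (a : P) (K : ℕ), ∀ b k, ∀ x ∈ (Sg a K) k b, (δf a K) b k x ≤ (W a K).wc k)
    (hvN₀ : (v : ℝ) * mB ≤ N₀) (hA : 0 ≤ A)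
    (hfan : fanout A N₀ ρ' < 1) (hamp : absorbAmplitude β₀ A N₀ ρ' ≤ A₀) :
    DressedStabilityWith 𝒯 A₀ (rhoOne (L ^ 2)⁻¹ (4 * cδ / r) cbar κ) (L⁻¹ ^ 3) :=
  dressedStabilityWith_of_canonicalSliceWinSchedules 𝒯 W hκ
    (s := fun a K b k => (snew a K) b k + ∑ i ∈ (I a K) b k, 2 * (N a K) b k i * (cV * (θ a K) b k i))
    Anch hratio hL hcbar hN₀ hA₀ hm hloc hρ'1 hsmall hr hcδ hsl hFn h𝒢 hB
    (fun a K b k' k h₁ h₂ h₃ h₄ =>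
      exponentSliceAt_of_valDepth ((I a K) b k) (h𝒜 a K b k)
        (hnew a K b k' k h₁ h₂ h₃ h₄) (hDom a K b k) (ht a K b k' k h₁ h₂ h₃ h₄) (htm a K b k) (hN a K b k' k h₁ h₂ h₃ h₄)
        (hroom0 a K b k) (hroom a K b k' k h₁ h₂ h₃ h₄) (hval a K b k' k h₁ h₂ h₃ h₄) (hq0 a K b k) (hq1 a K b k))
    hδf hDμ hz₁ hpairx hinv hmeas hdefwk hrate hne hsup hc0 hcb hreg hs₀ hLb
    hmult hscale hhoused hvol holder hsub habs hβ hQ hSg hcm hδfwk hvN₀ hA hfan hamp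

/-- **THE CANONICAL TERMINAL FACE ∘ (VAL-θ) DEPTH — THE ROW ROOT `DressedStability 𝒯` LITERALLY** [bookkeeping]: «NE1′ (all cutoffs, all
run parameters) ⇐ EXACTLY the displayed WALL binders ∀ (a,K) with (w2-act)'s `hE` READ THROUGH the new step's own slice + old pieces
analytic on their birth domains + (VAL-θ), THE NUMBER charged in the currency `snew + Σ 2N_i c_V θ_i`, + the H2 dictionary + anchoring ∕
absorption ∕ booking-convention DATA + located largeness + ratio-bounded cutoff-free-window schedules — no bookkeeping equality displayed»;
NOT proved; nothing instantiated on Bałaban's densities. [folklore] -/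
theorem dressedStability_of_depthSliceWinSchedules
    -- the (VAL-θ) DICTIONARY: the action exponent IS the new step's part plus the old pieces at the layer values
    (h𝒜 : ∀ (a : P) (K : ℕ), ∀ b k, ∀ U z,
      (𝒜 a K) b k U z = (𝒜new a K) b k U z + ∑ i ∈ (I a K) b k, (t a K) b k i ((val a K) b k U i) z)
    -- THE NUMBER, charged in the escrow currency (the history-indexed margin below `s̄⁰`)
    (hs₀ : ∀ (a : P) (K : ℕ), ∀ b k, (snew a K) b k + ∑ i ∈ (I a K) b k, 2 * (N a K) b k i * (cV * (θ a K) b k i) ≤ sbar)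
    -- the H2 dictionary the canonical data are built from (S3l)
    (hQ : ∀ (a : P) (K : ℕ), ∀ b k, (fun U z => (𝒬 a K) b k U z - (q a K) b k U) =
      fun U z => (c a K) b k * ∑ x ∈ (Sg a K) k b, ((Fn a K) x.1 x.2 k (U + z) - (Fn a K) x.1 x.2 k (U + (z₁ a K) b k)))
    (hSg : ∀ (a : P) (K : ℕ), ∀ k b, ∀ x ∈ (Sg a K) k b, x.1 ∈ (S a K) k b ∧ (𝒯.B a K).birthScale x.1 ≤ x.2 ∧ x.2 ≤ k)
    -- the two binders PARTICULAR to the assembled slice-window face (cutoff-free source tie, per-step slice guard)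
    (hcm : ∀ (a : P) (K : ℕ), ∀ b k, ‖(c a K) b k‖ ≤ m)
    (hδfwk : ∀ (a : P) (K : ℕ), ∀ b k, ∀ x ∈ (Sg a K) k b, (δf a K) b k x ≤ (W a K).wc k)
    (hvN₀ : (v : ℝ) * mB ≤ N₀) (hA : 0 ≤ A)
    (hfan : fanout A N₀ ρ' < 1) (hamp : absorbAmplitude β₀ A N₀ ρ' ≤ A₀) :
    DressedStability 𝒯 :=
  ⟨_, _, _, dressedStabilityWith_of_depthSliceWinSchedules 𝒯 W hκ Anch hratio hL hcbar hN₀ hA₀ hm hloc hρ'1 hsmall hr hcδ hsl hFn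
    h𝒢 hB hnew hDom ht htm hN hroom0 hroom hval hq0 hq1 hδf hDμ hz₁ hpairx hinv hmeas hdefwk hrate hne hsup hc0 hcb hreg hLb hmult
    hscale hhoused hvol holder hsub habs hβ h𝒜 hs₀ hQ hSg hcm hδfwk hvN₀ hA hfan hamp⟩

/-- **THE CANONICAL TERMINAL FACE ∘ (VAL-θ) DEPTH ⟹ ROOT-B `DressedBudget 𝒯 wt`** [bookkeeping]: with nonnegative cube weights bounded
by `w̄` and the SAME anchoring read as the bookings' positional count (`1 ≤ v`), S3l's `dressedBudget_of_canonicalSliceWinSchedules` BY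
NAME at the history-indexed margin with `hE` discharged from the (VAL-θ)∕depth data and THE NUMBER read in the escrow currency.
[folklore] -/
theorem dressedBudget_of_depthSliceWinSchedules
    -- the (VAL-θ) DICTIONARY: the action exponent IS the new step's part plus the old pieces at the layer values
    (h𝒜 : ∀ (a : P) (K : ℕ), ∀ b k, ∀ U z,
      (𝒜 a K) b k U z = (𝒜new a K) b k U z + ∑ i ∈ (I a K) b k, (t a K) b k i ((val a K) b k U i) z)
    -- THE NUMBER, charged in the escrow currency (the history-indexed margin below `s̄⁰`)
    (hs₀ : ∀ (a : P) (K : ℕ), ∀ b k, (snew a K) b k + ∑ i ∈ (I a K) b k, 2 * (N a K) b k i * (cV * (θ a K) b k i) ≤ sbar)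
    -- the H2 dictionary the canonical data are built from (S3l)
    (hQ : ∀ (a : P) (K : ℕ), ∀ b k, (fun U z => (𝒬 a K) b k U z - (q a K) b k U) =
      fun U z => (c a K) b k * ∑ x ∈ (Sg a K) k b, ((Fn a K) x.1 x.2 k (U + z) - (Fn a K) x.1 x.2 k (U + (z₁ a K) b k)))
    (hSg : ∀ (a : P) (K : ℕ), ∀ k b, ∀ x ∈ (Sg a K) k b, x.1 ∈ (S a K) k b ∧ (𝒯.B a K).birthScale x.1 ≤ x.2 ∧ x.2 ≤ k)
    -- the two binders PARTICULAR to the assembled slice-window face (cutoff-free source tie, per-step slice guard)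
    (hcm : ∀ (a : P) (K : ℕ), ∀ b k, ‖(c a K) b k‖ ≤ m)
    (hδfwk : ∀ (a : P) (K : ℕ), ∀ b k, ∀ x ∈ (Sg a K) k b, (δf a K) b k x ≤ (W a K).wc k)
    (hvN₀ : (v : ℝ) * mB ≤ N₀) (hA : 0 ≤ A)
    (hfan : fanout A N₀ ρ' < 1) (hamp : absorbAmplitude β₀ A N₀ ρ' ≤ A₀)
    {wt : P → ℕ → ℕ → ℝ} {wbar : ℝ} (hwbar : 0 ≤ wbar)
    (hw0 : ∀ a K, ∀ j ≤ K, 0 ≤ wt a K j) (hwb : ∀ a K, ∀ j ≤ K, wt a K j ≤ wbar) (hv : 1 ≤ v) :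
    DressedBudget 𝒯 wt :=
  dressedBudget_of_canonicalSliceWinSchedules 𝒯 W hκ
    (s := fun a K b k => (snew a K) b k + ∑ i ∈ (I a K) b k, 2 * (N a K) b k i * (cV * (θ a K) b k i))
    Anch hratio hL hcbar hN₀ hA₀ hm hloc hρ'1 hsmall hr hcδ hsl hFn h𝒢 hB
    (fun a K b k' k h₁ h₂ h₃ h₄ =>
      exponentSliceAt_of_valDepth ((I a K) b k) (h𝒜 a K b k)
        (hnew a K b k' k h₁ h₂ h₃ h₄) (hDom a K b k) (ht a K b k' k h₁ h₂ h₃ h₄) (htm a K b k) (hN a K b k' k h₁ h₂ h₃ h₄)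
        (hroom0 a K b k) (hroom a K b k' k h₁ h₂ h₃ h₄) (hval a K b k' k h₁ h₂ h₃ h₄) (hq0 a K b k) (hq1 a K b k))
    hδf hDμ hz₁ hpairx hinv hmeas hdefwk hrate hne hsup hc0 hcb hreg hs₀ hLb
    hmult hscale hhoused hvol holder hsub habs hβ hQ hSg hcm hδfwk hvN₀ hA hfan hamp hwbar hw0 hwb hv

end EndAll

end Summit.QuantumFields.BalabanUV.T4Continuum.NE1p.DressedStabilityOfDepthSliceWinSchedules

end
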